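import Literature.MathematicalPhysics.QuantumFieldTheory.Balaban1983to89.B7Prop3GeneralLinearSplitRec
import Literature.MathematicalPhysics.QuantumFieldTheory.Balaban1983to89.B7Prop3StaircaseStokesCovRec

/-!
# `Balaban1983to89.B7Prop3GaugeCarryRec` — [Balaban1985Averaging] PROPOSITION 3 AT A GENERAL BACKGROUND FOR THE RECORD's AVERAGING STRUCTURE ([Balaban1987RG1] (0.3)–(0.4)):
# THE CARRIED COARSE GAUGE LETTER `λ_A` OF (124)-FOR-THE-RECORD, THE GAUGE-CORRECTED LINEAR PART `Q̂(V₀)A`, AND THEIR BOOKKEEPING (road (A′) of director-ym №257∕№265, item N2b)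

statement-level skeleton of published theorems with citation tags; proofs where landed; nothing here is a claim about the Yang–Mills mass gap

CITATION HEADER (lean-in-tree rule).  Cell `pub-ymgap`, seat `pub-ymgap-dag-n05-e` g36 (N05-REC LEAD PEN); item R1 ([3] layer), the N2b file of director-ym №265 (2) «N2 REFINED = N2a
`B7Prop3GeneralLinearBoundRec` + N2b `B7Prop3GaugeCarryRec` (λ ↦ μ identities; Q^rec = Q̂ + d_cov Λ) + N2c `B7Prop3GeneralLinearPdevRec`».  `--kind definition --supports stmt-QuantumFields-20541`
(K0⁷; count-neutral; three small `def`s + theorems).  Sources READ: [3] = [Balaban1985Averaging] pp. 27–28 ((56)–(59)), 30–31 ((82), (93)), 34–36 ((112), (120), (122), (124)–(126))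
(`paper:balaban1985-cmp98-averaging`); [I] = [Balaban1987RG1] (0.3)–(0.4) pp. 252–253 (`paper:balaban1987-cmp109-rg-i-small-field`); the located memos `HOME/pub-ymgap-dag-n05-e/
LOCATED-N2-MIXED-LINEARISATION.md` (flat) and `LOCATED-N2-GENERAL-BACKGROUND.md` (general), `SOCKET-CHECK-N2.md` (g36).  Predecessor BY NAME: `B7Prop3GeneralLinearSplitRec` (`linQcovZ_split_gauge`,
`defects_eq_covGauge`, `FhatCovZ_eq_sum_IdxZ`), `B7Prop3GeneralTildRec` (`linQcovZ_eq`, linearity), `B7Prop3FlatRecSide` (`PhiZ`, `frame_cancellationZ`).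

WHY THIS FILE (the located point, typed — nothing hidden).  For the ENGINE's structure ([3] literally: one tree contour `Γ_{y,x}` both in the loop (15)∕(42) and in the frames (82)) the
linear part «L(Q(V₀)A)_c» of (122) is print's (124) and obeys (126) `|(Q(V₀)A)_c| ≤ (1 + O(1)L²α₀)|A|`.  For the RECORD ([I] (0.4): the loop runs over ALL shortest staircases `Γ^σ_{y,x}`,
uniform weights; frames (82) on the single staircase of the axial gauge, TOKEN RULE (T3)) the same computation gives (124) PLUS `D₀ + (d_{V̄₀}λ_A)(c)` (`B7Prop3GeneralLinearSplitRec.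
linQcovZ_split_gauge`): a small rotation defect `D₀` and the COVARIANT COARSE DERIVATIVE of the site functional `λ_A(y) = mean_{(r,σ)}[(R_{0,y}A)(Γ^σ_{y,x}) − (R_{0,y}A)(Γ_{y,x})]` — a
curl functional (lattice Stokes between the two staircases), NOT small in `sup|A|` (flat witness `d = 2`, `L = 3`: `0.31·|A|`), small in the CURVATURE of `A`.  Road (A′) (director-ym №257∕№265,
plan SIZING): keep the premise `HThm4Rec` as typed and CARRY `λ_A` as a letter: the record's linearised one-step average is `Q̂(V₀)A + (d_{V̄₀}λ_A)`, with `Q̂` obeying (126)∕(128) verbatim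
(N2a∕N2c) and the carried term bounded on the DATA side of [Balaban1985RegularSpaces] (1.56) by the Stokes estimate (sequel).  This file fixes the three objects and their exact bookkeeping:
the generator `lamZ` (= `λ_A`), the covariant coarse derivative `dcovZ` along the averaged bond `V̄₀(c)` ((59)∕(93): the linearisation of `\overline{V^{e^λ}} = V̄^{e^{λ}}` at the block
centres), and `QhatZ := linQcovZ − dcovZ (lamZ)`.
WHAT IS PROVED (sorry-free).  §1 the three definitions + unfolding lemmas; §2 ★`lamZ_eq_mean` (`λ_A = mean_i [(R_{0,y}A)(Γ^σ) − (R_{0,y}A)(Γ)]`), ★`linQcovZ_eq_QhatZ_add_dcovZ` («L(Q(V₀)A)_c =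
Q̂(V₀)A + (d_{V̄₀}λ_A)(c)», by definition), `defects_eq_dcovZ_lamZ` (`D₋ + D₊ = (d_{V̄₀}λ_A)(c)`, = `defects_eq_covGauge`), ★★`QhatZ_eq_split` (`Q̂ = L·Q₀ + print's three brackets + D₀` — (124)
term by term with `Γ ↦ Γ^σ`, the engine's `linQcov_split` shape); §3 AT `V₀ = 1`: `dcovZ_one_left` (plain coarse difference), ★`lamZ_one_left` (`λ_A = Φ_A` of `B7Prop3FlatRecSide`),
`QprimeCovZ_one_left`, ★`linQcovZ_one_left` (`L(Q(1)A)_c = L(Q₀A)_c + Φ(c₋) − Φ(c₊)` — the flat LOCATED-N2 identity in (122)'s own letter), ★★`QhatZ_one_left` (`Q̂(1) = L·Q₀` = print's straight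
block average (125) EXACTLY: the gauge-corrected part IS the engine's flat linear part `B7Prop3Flat.linQ` read on centred blocks); §4 linearity of `lamZ`, `dcovZ`, `QhatZ` in `A`;
§5 GAUGE COVARIANCE (with `B7Prop3StaircaseStokesCovRec.tsum_gaugeAct`: (58) under (8)): `FhatCovZ_gaugeAct`, ★`lamZ_gaugeAct`, `dcovZ_gaugeAct` — the carried
letter transforms as a site field in the adjoint representation, so its norm may be computed in ANY gauge of `V₀` (the Stokes estimate uses the block axial gauge); §6 norms: `norm_dcovZ_le`,
`norm_lamZ_le_length` (`‖λ_A‖ ≤ 2dL·|A|`, the trivial length bound with no small factor — the located point), ★★★`norm_lamZ_le` — THE N2 ESTIMATE `‖λ_A(y)‖ ≤ (d·s)²·P +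
36(d·s)²(d·s+4)·α₀·|A|` (`P` = a bound of the covariant plaquette curls `‖(R_{0,x}A)(∂p)‖` on the block, `α₀` = the background's plaquette regularity (44); by
`B7Prop3StaircaseStokesCovRec.norm_stairMean_sub_FhatCovZ_le`) and ★`norm_dcovZ_lamZ_le` (the carried gauge term of one `L`-bond: twice that).
HONEST SCOPE.  Definitions and exact identities for OUR typed record objects, the trivial norm bounds and the curvature bound re-keyed from the Stokes files; nothing of [3]∕[6]∕[I] asserted; `HThm4Rec`
UNDISCHARGED; N05 discharged of record untouched; N07 not claimable; counts unmoved (typed 28∕28 · discharged 8∕28); one finite 𝕋⁴ programme at fixed ε — nothing continuum ∕ ℝ⁴ ∕ OS ∕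
mass gap ∕ Clay.  Three `def`s, no `instance`, no `notation`, no `sorry`.
-/

set_option autoImplicit false

noncomputable section

open scoped BigOperators
open NormedSpace Finset

namespace Literature.MathematicalPhysics.QuantumFieldTheory.Balaban1983to89.B7Prop3GaugeCarryRec

open B7Prop1Explicit hiding Site
open B7Prop1Explicit renaming Site → SiteZ
open MatrixLog B7AvgGaugeCovariance B7Prop3GeneralRotated
open B7Prop3Flat (expCfg)
open B7Prop3GeneralTild (tsum_add tsum_smul)
open B7Eq78Linearization (conjR conjR_apply conjR_add conjR_sub conjR_smul conjR_smul_real conjR_one)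
open B12AverageCorridor267 (Dmlog Dmlog_one Dexp Dexp_zero PhiY PhiY_apply)
open BlockAveragingZd (offZ IdxZ WZ WZ_def WZ_one WZ_gaugeAct XZ XZ_one bavgZ bavgZ_apply bavgZ_one)
open BlockAveragingZdCovariance (bavgZ_gaugeAct_units)
open B7SectEFLinearisationRec (FhatZ linQZ FhatCovZ Q0covZ QcovZ linQcovZ AloopZ DXavgZ QprimeCovZ)
open B7Prop3FlatRecSide (SZ PhiZ XhatZ TsideZ XhatZ_eq frame_cancellationZ sum_IdxZ_fst sum_IdxZ_perm₁ sum_IdxZ_const norm_avgZ_le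
  l1_offZ_le_dL)
open B7Prop3GeneralLinearRec (FhatCovZ_one_left)
open B7Prop3GeneralTildRec (linQcovZ_eq linQcovZ_add linQcovZ_smul FhatCovZ_add FhatCovZ_smul)
open B7Prop3GeneralLinearSplitRec (FhatCovZ_eq_sum_IdxZ defects_eq_covGauge linQcovZ_split_gauge)
open B7Prop3GeneralLinearSplit (conjR_sum)
open B7Prop3StaircaseStokesCovRec (tstep_gaugeAct tsum_gaugeAct norm_stairMean_sub_FhatCovZ_le)
open B8Eq191FlatStencils (conjR_unitOne)
open T4Continuum (loopWord stairWord)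
open BlockAveragingZd (length_stairWord)

variable {d : ℕ}

variable {𝔸 : Type*} [NormedRing 𝔸] [NormedAlgebra ℂ 𝔸] [NormOneClass 𝔸] [CompleteSpace 𝔸]
variable (L : ℕ)

omit [NormOneClass 𝔸] in
/-- `e^{0} = 1` as a unit. [cite: Balaban1985Averaging, (109) p.34] -/
private theorem expUnit_zero' : expUnit (0 : 𝔸) = 1 :=
  Units.ext (by simp [expUnit])

/-! ## §1 The carried letter `λ_A`, the covariant coarse derivative `d_{V̄₀}`, the gauge-corrected linear part `Q̂(V₀)A` -/

section Defs

/-- **THE CARRIED COARSE GAUGE LETTER `λ_A(y)`** of (124)-for-the-record: the σ-MEAN staircase frame minus the SINGLE-staircase frame (112),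
`λ_A(y) := Σ_i |IdxZ|⁻¹·(R_{0,y}A)(Γ^σ_{y,x}) − F̂_{V₀}(y)`, `i = (r, σ, σ′)`, `x = y + offZ L r` — the generator of the infinitesimal coarse gauge transformation by which the
record's linearised one-step average differs from the engine-shaped one (`B7Prop3GeneralLinearSplitRec.defects_eq_covGauge`).  Zero for the engine's structure (`Γ^σ = Γ`); at `V₀ = 1` it is
`B7Prop3FlatRecSide.PhiZ` (`lamZ_one_left`). [cite: Balaban1985Averaging, (112) p.34, (124) p.36; Balaban1987RG1, (0.3)–(0.4) pp.252–253] -/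
def lamZ (V₀ : SiteZ d → Fin d → 𝔸ˣ) (A : SiteZ d → Fin d → 𝔸) (y : SiteZ d) : 𝔸 :=
  (∑ i : IdxZ d L, ((Fintype.card (IdxZ d L) : ℝ))⁻¹ • tsum V₀ A y (stairWord i.2.1 (offZ L i.1))) - FhatCovZ L V₀ A y

/-- **THE COVARIANT COARSE DERIVATIVE ALONG THE AVERAGED BOND** `c = ⟨q, q + Le_κ⟩`: `(d_{V̄₀}f)(c) := f(c₋) − R(V̄₀(c)) f(c₊)`, `V̄₀(c) = bavgZ L V₀ q κ` — the linearisation at `λ = 0` of the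
coarse gauge action `V̄(c) ↦ e^{λ(c₋)} V̄(c) e^{−λ(c₊)}` by which (59)∕(93) «`\overline{V^u} = V̄^{u}`» transports a gauge transformation to the coarse lattice (the units absorbed in the exponent as
everywhere in the lineage). [cite: Balaban1985Averaging, (59) p.27, (93) p.31] -/
def dcovZ (V₀ : SiteZ d → Fin d → 𝔸ˣ) (f : SiteZ d → 𝔸) (q : SiteZ d) (κ : Fin d) : 𝔸 :=
  f q - conjR (bavgZ L V₀ q κ) (f (q + (L : ℤ) • e κ))

/-- **THE GAUGE-CORRECTED LINEAR PART `Q̂(V₀)A`** of the record's one-step average: «L(Q(V₀)A)_c» of (122) (`linQcovZ`) MINUS the carried coarse gauge term `(d_{V̄₀}λ_A)(c)`.  By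
`QhatZ_eq_split` it is print's (124) term by term (`Γ ↦ Γ^σ`) plus the rotation defect `D₀`; by `QhatZ_one_left` it is EXACTLY print's straight block average `L·(Q₀A)_c` (125) at `V₀ = 1`;
(126) holds for it (`B7Prop3GeneralLinearBoundRec.norm_linQcovZ_gaugeCorrected_le`). [cite: Balaban1985Averaging, (122) p.36, (124)–(126) p.36] -/
def QhatZ (V₀ : SiteZ d → Fin d → 𝔸ˣ) (A : SiteZ d → Fin d → 𝔸) (q : SiteZ d) (κ : Fin d) : 𝔸 :=
  linQcovZ L V₀ A q κ - dcovZ L V₀ (lamZ L V₀ A) q κ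

omit [NormOneClass 𝔸] [CompleteSpace 𝔸] in
/-- Unfolding `lamZ`. [cite: Balaban1985Averaging, (112) p.34, (124) p.36] -/
theorem lamZ_def (V₀ : SiteZ d → Fin d → 𝔸ˣ) (A : SiteZ d → Fin d → 𝔸) (y : SiteZ d) :
    lamZ L V₀ A y = (∑ i : IdxZ d L, ((Fintype.card (IdxZ d L) : ℝ))⁻¹ • tsum V₀ A y (stairWord i.2.1 (offZ L i.1)))
      - FhatCovZ L V₀ A y := rfl

omit [NormOneClass 𝔸] in
/-- Unfolding `dcovZ`. [cite: Balaban1985Averaging, (59) p.27, (93) p.31] -/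
theorem dcovZ_apply (V₀ : SiteZ d → Fin d → 𝔸ˣ) (f : SiteZ d → 𝔸) (q : SiteZ d) (κ : Fin d) :
    dcovZ L V₀ f q κ = f q - conjR (bavgZ L V₀ q κ) (f (q + (L : ℤ) • e κ)) := rfl

omit [NormOneClass 𝔸] in
/-- Unfolding `QhatZ`. [cite: Balaban1985Averaging, (122) p.36, (124) p.36] -/
theorem QhatZ_def (V₀ : SiteZ d → Fin d → 𝔸ˣ) (A : SiteZ d → Fin d → 𝔸) (q : SiteZ d) (κ : Fin d) :
    QhatZ L V₀ A q κ = linQcovZ L V₀ A q κ - dcovZ L V₀ (lamZ L V₀ A) q κ := rfl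

end Defs

/-! ## §2 Exact bookkeeping: `λ_A` as a mean of staircase differences; «L(Q(V₀)A)_c = Q̂(V₀)A + (d_{V̄₀}λ_A)(c)»; `Q̂ = L·Q₀ + three brackets + D₀` -/

section Identities

omit [NormOneClass 𝔸] [CompleteSpace 𝔸] in
/-- ★ **`λ_A(y) = Σ_i |IdxZ|⁻¹·[(R_{0,y}A)(Γ^σ_{y,x}) − (R_{0,y}A)(Γ_{y,x})]`** — the mean over the loop index of the rotated line sums along the σ-staircase MINUS along the tree
staircase (same end points): each summand is a lattice-Stokes surface term, i.e. `λ_A` is a CURL functional. [cite: Balaban1985Averaging, (112) p.34, (58) p.27; Balaban1987RG1, (0.3) p.252] -/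
theorem lamZ_eq_mean (hL : 1 ≤ L) (V₀ : SiteZ d → Fin d → 𝔸ˣ) (A : SiteZ d → Fin d → 𝔸) (y : SiteZ d) :
    lamZ L V₀ A y = ∑ i : IdxZ d L, ((Fintype.card (IdxZ d L) : ℝ))⁻¹ •
      (tsum V₀ A y (stairWord i.2.1 (offZ L i.1)) - tsum V₀ A y (treeWord (offZ L i.1))) := by
  rw [lamZ_def, FhatCovZ_eq_sum_IdxZ L hL]
  simp only [smul_sub, Finset.sum_sub_distrib]

omit [NormOneClass 𝔸] in
/-- ★ **«L(Q(V₀)A)_c = Q̂(V₀)A + (d_{V̄₀}λ_A)(c)»** — the record's linearised one-step average IS the gauge-corrected part followed by the infinitesimal coarse gauge transformation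
generated by `λ_A` (by definition of `Q̂`; the content is `QhatZ_eq_split`). [cite: Balaban1985Averaging, (122) p.36, (124) p.36, (93) p.31] -/
theorem linQcovZ_eq_QhatZ_add_dcovZ (V₀ : SiteZ d → Fin d → 𝔸ˣ) (A : SiteZ d → Fin d → 𝔸) (q : SiteZ d) (κ : Fin d) :
    linQcovZ L V₀ A q κ = QhatZ L V₀ A q κ + dcovZ L V₀ (lamZ L V₀ A) q κ := by
  rw [QhatZ_def, sub_add_cancel]

omit [NormOneClass 𝔸] in
/-- **`D₋ + D₊ = (d_{V̄₀}λ_A)(c)`** — `B7Prop3GeneralLinearSplitRec.defects_eq_covGauge` in the letters of this file. [cite: Balaban1985Averaging, (124) p.36, (93) p.31; Balaban1987RG1, (0.4) p.253] -/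
theorem defects_eq_dcovZ_lamZ (hL : 1 ≤ L) (V₀ : SiteZ d → Fin d → 𝔸ˣ) (A : SiteZ d → Fin d → 𝔸) (q : SiteZ d) (κ : Fin d) :
    (∑ i : IdxZ d L, ((Fintype.card (IdxZ d L) : ℝ))⁻¹ • tsum V₀ A q (stairWord i.2.1 (offZ L i.1)) - FhatCovZ L V₀ A q)
      + ∑ i : IdxZ d L, ((Fintype.card (IdxZ d L) : ℝ))⁻¹ •
          conjR (expUnit (XZ L V₀ q κ)) (conjR (hol V₀ q (seg κ L))
            (tsum V₀ A (q + (L : ℤ) • e κ) (treeWord (offZ L i.1))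
              - tsum V₀ A (q + (L : ℤ) • e κ) (stairWord i.2.2 (offZ L i.1))))
      = dcovZ L V₀ (lamZ L V₀ A) q κ := by
  rw [defects_eq_covGauge L hL, dcovZ_apply, lamZ_def, lamZ_def]

/-- ★★ **`Q̂(V₀)A = L·(Q₀A)_c + [Φ-bracket] + [𝒜-bracket] + [third bracket] + D₀`** — print's (124) TERM BY TERM (the engine's `linQcov_split` with `Γ ↦ Γ^σ`, `Γ′ ↦ Γ^{σ′}`) plus the
rotation defect `D₀ = Σ_i w·R(V₀(Γ^σ_{c₋,x}))(R_{0,x}A)([x,x′]) − L·(Q₀A)_c` (zero at a flat background, `≤ 2ε′·L·|A|` by `B7Prop3GeneralLinearBoundRec.norm_D0Z_le`), under the small-loop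
guard `‖W_i(V₀) − 1‖ < 1`.  This is the object for which (126) holds. [cite: Balaban1985Averaging, (124)–(126) p.36; Balaban1987RG1, (0.4) p.253] -/
theorem QhatZ_eq_split (hL : 1 ≤ L) (V₀ : SiteZ d → Fin d → 𝔸ˣ) (A : SiteZ d → Fin d → 𝔸) (q : SiteZ d) (κ : Fin d)
    (hW : ∀ i : IdxZ d L, ‖((WZ L V₀ q κ i : 𝔸ˣ) : 𝔸) - 1‖ < 1) :
    QhatZ L V₀ A q κ
      = (L : ℝ) • Q0covZ L V₀ A q κ
        + (PhiY (XZ L V₀ q κ) (DXavgZ L V₀ A q κ)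
            - ∑ i : IdxZ d L, ((Fintype.card (IdxZ d L) : ℝ))⁻¹ • AloopZ L V₀ A q κ i)
        + (conjR (expUnit (XZ L V₀ q κ)) (tsum V₀ A q (seg κ L))
            - ∑ i : IdxZ d L, ((Fintype.card (IdxZ d L) : ℝ))⁻¹ • conjR (WZ L V₀ q κ i) (tsum V₀ A q (seg κ L)))
        + ∑ i : IdxZ d L, ((Fintype.card (IdxZ d L) : ℝ))⁻¹ •
            (conjR (expUnit (XZ L V₀ q κ))
                (conjR (hol V₀ q (seg κ L)) (tsum V₀ A (q + (L : ℤ) • e κ) (stairWord i.2.2 (offZ L i.1))))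
              - conjR (WZ L V₀ q κ i)
                (conjR (hol V₀ q (seg κ L)) (tsum V₀ A (q + (L : ℤ) • e κ) (stairWord i.2.2 (offZ L i.1)))))
        + (∑ i : IdxZ d L, ((Fintype.card (IdxZ d L) : ℝ))⁻¹ •
              conjR (hol V₀ q (stairWord i.2.1 (offZ L i.1))) (tsum V₀ A (q + offZ L i.1) (seg κ L))
            - (L : ℝ) • Q0covZ L V₀ A q κ) := by
  rw [QhatZ_def, linQcovZ_split_gauge L hL V₀ A q κ hW, ← defects_eq_dcovZ_lamZ L hL, defects_eq_covGauge L hL]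
  abel

end Identities

/-! ## §3 At the flat background `V₀ = 1`: `λ_A = Φ_A`, «L(Q(1)A)_c» `= L·(Q₀A)_c + Φ(c₋) − Φ(c₊)`, and `Q̂(1)A = L·(Q₀A)_c` EXACTLY -/

section Flat

omit [NormOneClass 𝔸] in
/-- At `V₀ = 1` the averaged bond is `1` and the covariant coarse derivative is the plain difference `f(c₋) − f(c₊)`. [cite: Balaban1985Averaging, (59) p.27, (93) p.31] -/
theorem dcovZ_one_left (f : SiteZ d → 𝔸) (q : SiteZ d) (κ : Fin d) :
    dcovZ L (1 : SiteZ d → Fin d → 𝔸ˣ) f q κ = f q - f (q + (L : ℤ) • e κ) := by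
  rw [dcovZ_apply, bavgZ_one, conjR_unitOne]

omit [NormOneClass 𝔸] [CompleteSpace 𝔸] in
/-- ★ **At `V₀ = 1` the carried letter is the curvature functional `Φ_A` of `B7Prop3FlatRecSide`** (`R_{0,y} = id`: `(R_{0,y}A)(Γ) = A(Γ)`, so σ-mean staircase minus tree staircase
`= SZ − FhatZ = PhiZ`). [cite: Balaban1985Averaging, (110)–(112) p.34; Balaban1987RG1, (0.3)–(0.4) pp.252–253] -/
theorem lamZ_one_left (A : SiteZ d → Fin d → 𝔸) (y : SiteZ d) :
    lamZ L (1 : SiteZ d → Fin d → 𝔸ˣ) A y = PhiZ L A y := by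
  rw [lamZ_def, FhatCovZ_one_left]
  simp only [tsum_one_left]
  rfl

/-- At `V₀ = 1`, `(Q′(V₀)A)_c` (119) is the first-order term `T_c = X̂ + A([q, q′])` of the record average itself (`XZ(1) = 0`, `W_i(1) = 1`, `g(0) = 1`, `(D log)_1 = id`).
[cite: Balaban1985Averaging, (117)–(119) p.35, (47)–(48) p.25] -/
theorem QprimeCovZ_one_left (A : SiteZ d → Fin d → 𝔸) (q : SiteZ d) (κ : Fin d) :
    QprimeCovZ L (1 : SiteZ d → Fin d → 𝔸ˣ) A q κ = TsideZ L A q κ := by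
  unfold QprimeCovZ DXavgZ AloopZ TsideZ XhatZ
  simp only [XZ_one, WZ_one, Units.val_one, mul_one, tsum_one_left, Dmlog_one, ContinuousLinearMap.id_apply, PhiY_apply,
    Dexp_zero, neg_zero, NormedSpace.exp_zero, expUnit_zero', conjR_unitOne]

/-- ★ **THE FLAT LOCATED-N2 IDENTITY IN (122)'s OWN LETTER: «L(Q(1)A)_c» `= L·(Q₀A)_c + Φ_A(c₋) − Φ_A(c₊)`** — the engine has `linQcov_one_left : linQcov 1 A = linQ A` (frames cancel the
tree-contour pieces exactly, `B7Prop3Flat.frame_cancellation`); for the record the single-staircase frames cancel the σ-mean staircases only up to the curl functional `Φ`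
(`B7Prop3FlatRecSide.frame_cancellationZ`).  From the closed form (120) (`linQcovZ_eq`) at `V₀ = 1`. [cite: Balaban1985Averaging, (120) p.35, (122) p.36, (125) p.36; Balaban1987RG1, (0.4) p.253] -/
theorem linQcovZ_one_left (hL : 1 ≤ L) (A : SiteZ d → Fin d → 𝔸) (q : SiteZ d) (κ : Fin d) :
    linQcovZ L (1 : SiteZ d → Fin d → 𝔸ˣ) A q κ = linQZ L A q κ + PhiZ L A q - PhiZ L A (q + (L : ℤ) • e κ) := by
  have hW : ∀ i : IdxZ d L, ‖((WZ L (1 : SiteZ d → Fin d → 𝔸ˣ) q κ i : 𝔸ˣ) : 𝔸) - 1‖ < 1 := by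
    intro i
    simp [WZ_one]
  rw [linQcovZ_eq L _ A q κ hW, QprimeCovZ_one_left, bavgZ_one, conjR_unitOne, FhatCovZ_one_left, FhatCovZ_one_left,
    ← frame_cancellationZ L hL]

/-- ★★ **`Q̂(1)A = L·(Q₀A)_c` EXACTLY** — the gauge-corrected linear part of the record's flat average IS print's straight block average (125) («it resembles the definition of the
averaging operation Q in [2]», [Balaban1984PropagatorsI] (1.11)) read on centred blocks: the curl functional is carried entirely by the gauge term.  This is the identity behind
the flat-letter layer's reading `Q_j(1) = L^j·Q_j` for `Q̂`. [cite: Balaban1985Averaging, (125) p.36, (122) p.36; Balaban1984PropagatorsI, (1.11) p.19] -/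
theorem QhatZ_one_left (hL : 1 ≤ L) (A : SiteZ d → Fin d → 𝔸) (q : SiteZ d) (κ : Fin d) :
    QhatZ L (1 : SiteZ d → Fin d → 𝔸ˣ) A q κ = linQZ L A q κ := by
  rw [QhatZ_def, linQcovZ_one_left L hL, dcovZ_one_left, lamZ_one_left, lamZ_one_left]
  abel

end Flat

/-! ## §4 Linearity in `A` -/

section Linear

omit [NormOneClass 𝔸] [CompleteSpace 𝔸] in
/-- `λ` is additive in `A`. [cite: Balaban1985Averaging, (112) p.34, (122) p.36] -/
theorem lamZ_add (V₀ : SiteZ d → Fin d → 𝔸ˣ) (A A' : SiteZ d → Fin d → 𝔸) (y : SiteZ d) :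
    lamZ L V₀ (A + A') y = lamZ L V₀ A y + lamZ L V₀ A' y := by
  rw [lamZ_def, lamZ_def, lamZ_def, FhatCovZ_add]
  simp only [tsum_add, smul_add, Finset.sum_add_distrib]
  abel

omit [NormOneClass 𝔸] [CompleteSpace 𝔸] in
/-- `λ` is `ℂ`-homogeneous in `A`. [cite: Balaban1985Averaging, (112) p.34, (122) p.36] -/
theorem lamZ_smul (V₀ : SiteZ d → Fin d → 𝔸ˣ) (c : ℂ) (A : SiteZ d → Fin d → 𝔸) (y : SiteZ d) :
    lamZ L V₀ (c • A) y = c • lamZ L V₀ A y := by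
  rw [lamZ_def, lamZ_def, FhatCovZ_smul, smul_sub, Finset.smul_sum]
  simp only [tsum_smul, smul_comm c]

omit [NormOneClass 𝔸] [CompleteSpace 𝔸] in
/-- `λ` of a difference. [cite: Balaban1985Averaging, (112) p.34, (122) p.36] -/
theorem lamZ_sub (V₀ : SiteZ d → Fin d → 𝔸ˣ) (A A' : SiteZ d → Fin d → 𝔸) (y : SiteZ d) :
    lamZ L V₀ (A - A') y = lamZ L V₀ A y - lamZ L V₀ A' y := by
  rw [sub_eq_add_neg, lamZ_add, show -A' = (-1 : ℂ) • A' by simp, lamZ_smul]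
  simp [sub_eq_add_neg]

omit [NormOneClass 𝔸] in
/-- `d_{V̄₀}` is additive. [cite: Balaban1985Averaging, (59) p.27, (93) p.31] -/
theorem dcovZ_add (V₀ : SiteZ d → Fin d → 𝔸ˣ) (f g : SiteZ d → 𝔸) (q : SiteZ d) (κ : Fin d) :
    dcovZ L V₀ (f + g) q κ = dcovZ L V₀ f q κ + dcovZ L V₀ g q κ := by
  simp only [dcovZ_apply, Pi.add_apply, conjR_add]
  abel

omit [NormOneClass 𝔸] in
/-- `d_{V̄₀}` is `ℂ`-homogeneous. [cite: Balaban1985Averaging, (59) p.27, (93) p.31] -/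
theorem dcovZ_smul (V₀ : SiteZ d → Fin d → 𝔸ˣ) (c : ℂ) (f : SiteZ d → 𝔸) (q : SiteZ d) (κ : Fin d) :
    dcovZ L V₀ (c • f) q κ = c • dcovZ L V₀ f q κ := by
  simp only [dcovZ_apply, Pi.smul_apply, conjR_smul, smul_sub]

omit [NormOneClass 𝔸] in
/-- `d_{V̄₀}` depends only on the values of `f` at the two ends of `c`. [cite: Balaban1985Averaging, (59) p.27, (93) p.31] -/
theorem dcovZ_congr (V₀ : SiteZ d → Fin d → 𝔸ˣ) {f g : SiteZ d → 𝔸} (q : SiteZ d) (κ : Fin d) (h₁ : f q = g q)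
    (h₂ : f (q + (L : ℤ) • e κ) = g (q + (L : ℤ) • e κ)) : dcovZ L V₀ f q κ = dcovZ L V₀ g q κ := by
  rw [dcovZ_apply, dcovZ_apply, h₁, h₂]

/-- `Q̂(V₀)` is additive in `A` (under the small-loop guard of (120)). [cite: Balaban1985Averaging, (122) p.36, (124) p.36] -/
theorem QhatZ_add (V₀ : SiteZ d → Fin d → 𝔸ˣ) (A A' : SiteZ d → Fin d → 𝔸) (q : SiteZ d) (κ : Fin d)
    (hW : ∀ i : IdxZ d L, ‖((WZ L V₀ q κ i : 𝔸ˣ) : 𝔸) - 1‖ < 1) :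
    QhatZ L V₀ (A + A') q κ = QhatZ L V₀ A q κ + QhatZ L V₀ A' q κ := by
  have h : lamZ L V₀ (A + A') = lamZ L V₀ A + lamZ L V₀ A' := funext fun y => lamZ_add L V₀ A A' y
  rw [QhatZ_def, QhatZ_def, QhatZ_def, linQcovZ_add L V₀ A A' q κ hW, h, dcovZ_add]
  abel

/-- `Q̂(V₀)` is `ℂ`-homogeneous in `A` (under the small-loop guard of (120)). [cite: Balaban1985Averaging, (122) p.36, (124) p.36] -/
theorem QhatZ_smul (V₀ : SiteZ d → Fin d → 𝔸ˣ) (c : ℂ) (A : SiteZ d → Fin d → 𝔸) (q : SiteZ d) (κ : Fin d)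
    (hW : ∀ i : IdxZ d L, ‖((WZ L V₀ q κ i : 𝔸ˣ) : 𝔸) - 1‖ < 1) :
    QhatZ L V₀ (c • A) q κ = c • QhatZ L V₀ A q κ := by
  have h : lamZ L V₀ (c • A) = c • lamZ L V₀ A := funext fun y => lamZ_smul L V₀ c A y
  rw [QhatZ_def, QhatZ_def, linQcovZ_smul L V₀ c A q κ hW, h, dcovZ_smul, smul_sub]

end Linear

/-! ## §5 Gauge covariance: the carried letter is a site field in the adjoint representation -/

section Gauge

variable {G : Type*}

omit [NormOneClass 𝔸] [CompleteSpace 𝔸] in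
/-- The single-staircase frame (112) is covariant: `F̂_{V₀^u}(R(u)A)(y) = R(u(y))F̂_{V₀}(A)(y)`. [cite: Balaban1985Averaging, (112) p.34, (8) p.18] -/
theorem FhatCovZ_gaugeAct (u : SiteZ d → 𝔸ˣ) (V₀ : SiteZ d → Fin d → 𝔸ˣ) (A : SiteZ d → Fin d → 𝔸) (y : SiteZ d) :
    FhatCovZ L (gaugeAct u V₀) (fun z μ => conjR (u z) (A z μ)) y = conjR (u y) (FhatCovZ L V₀ A y) := by
  unfold FhatCovZ
  rw [conjR_sum]
  simp only [tsum_gaugeAct, conjR_smul_real]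

omit [NormOneClass 𝔸] [CompleteSpace 𝔸] in
/-- ★ **THE CARRIED LETTER IS COVARIANT**: `λ_{R(u)A}[V₀^u](y) = R(u(y))·λ_A[V₀](y)` — so `‖λ_A(y)‖` may be computed in any gauge of the background (for `u(y) ∈ U1`; the Stokes estimate
uses the block axial gauge rooted at `y`). [cite: Balaban1985Averaging, (8) p.18, (58) p.27, (112) p.34; Balaban1987RG1, (0.4) p.253] -/
theorem lamZ_gaugeAct (u : SiteZ d → 𝔸ˣ) (V₀ : SiteZ d → Fin d → 𝔸ˣ) (A : SiteZ d → Fin d → 𝔸) (y : SiteZ d) :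
    lamZ L (gaugeAct u V₀) (fun z μ => conjR (u z) (A z μ)) y = conjR (u y) (lamZ L V₀ A y) := by
  rw [lamZ_def, lamZ_def, FhatCovZ_gaugeAct, conjR_sub, conjR_sum]
  simp only [tsum_gaugeAct, conjR_smul_real]

omit [NormOneClass 𝔸] in
/-- The covariant coarse derivative is covariant: with (93) «`\overline{V^u} = V̄^{u}`» at the block centres (`bavgZ_gaugeAct_units`),
`(d_{\overline{V₀^u}} R(u)f)(c) = R(u(c₋))·(d_{V̄₀}f)(c)`. [cite: Balaban1985Averaging, (93) p.31, (59) p.27] -/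
theorem dcovZ_gaugeAct (u : SiteZ d → 𝔸ˣ) (V₀ : SiteZ d → Fin d → 𝔸ˣ) (f : SiteZ d → 𝔸) (q : SiteZ d) (κ : Fin d) :
    dcovZ L (gaugeAct u V₀) (fun z => conjR (u z) (f z)) q κ = conjR (u q) (dcovZ L V₀ f q κ) := by
  rw [dcovZ_apply, dcovZ_apply, bavgZ_gaugeAct_units, conjR_mul_left, conjR_mul_left, ← conjR_mul_left (u (q + (L : ℤ) • e κ))⁻¹,
    inv_mul_cancel, conjR_unitOne, conjR_sub]

end Gauge

/-! ## §6 A-priori norms (the curvature bound of `λ_A` is the sequel's) -/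

section Norms

/-- `‖(d_{V̄₀}f)(c)‖ ≤ ‖f(c₋)‖ + ‖f(c₊)‖` when the averaged bond lies in the norm-one class `U1` (rotations do not increase norms). [cite: Balaban1985Averaging, (56)–(57) p.27, (93) p.31] -/
theorem norm_dcovZ_le {V₀ : SiteZ d → Fin d → 𝔸ˣ} (f : SiteZ d → 𝔸) (q : SiteZ d) (κ : Fin d) (hb : bavgZ L V₀ q κ ∈ U1 𝔸) :
    ‖dcovZ L V₀ f q κ‖ ≤ ‖f q‖ + ‖f (q + (L : ℤ) • e κ)‖ := by
  rw [dcovZ_apply]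
  exact (norm_sub_le _ _).trans (add_le_add le_rfl (norm_conjR_le hb _))

/-- In particular `‖(d_{V̄₀}f)(c)‖ ≤ 2·sup‖f‖`. [cite: Balaban1985Averaging, (56)–(57) p.27, (93) p.31] -/
theorem norm_dcovZ_le_of_sup {V₀ : SiteZ d → Fin d → 𝔸ˣ} {f : SiteZ d → 𝔸} {m : ℝ} (hf : ∀ y, ‖f y‖ ≤ m) (q : SiteZ d) (κ : Fin d)
    (hb : bavgZ L V₀ q κ ∈ U1 𝔸) : ‖dcovZ L V₀ f q κ‖ ≤ 2 * m :=
  (norm_dcovZ_le L f q κ hb).trans (by linarith [hf q, hf (q + (L : ℤ) • e κ)])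

omit [CompleteSpace 𝔸] in
/-- The trivial LENGTH bound `‖λ_A(y)‖ ≤ 2dL·|A|` (both staircases have `|Γ| = |x − y|₁ ≤ dL`; rotations do not increase norms).  The located point is precisely that this bound has no
small factor; the useful bound is by the curvature of `A` (lattice Stokes, sequel). [cite: Balaban1985Averaging, (125)–(126) p.36; Balaban1987RG1, (0.3) p.252] -/
theorem norm_lamZ_le_length (hL : 1 ≤ L) {V₀ : SiteZ d → Fin d → 𝔸ˣ} (hV₀ : ∀ x κ, V₀ x κ ∈ U1 𝔸)
    {A : SiteZ d → Fin d → 𝔸} {a : ℝ} (ha : 0 ≤ a) (hA : ∀ x κ, ‖A x κ‖ ≤ a) (y : SiteZ d) :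
    ‖lamZ L V₀ A y‖ ≤ 2 * (d * L) * a := by
  rw [lamZ_eq_mean L hL]
  refine norm_avgZ_le L hL _ fun i => ?_
  have h1 : ‖tsum V₀ A y (stairWord i.2.1 (offZ L i.1))‖ ≤ (d * L) * a := by
    refine (norm_tsum_le hV₀ hA _ _).trans ?_
    rw [length_stairWord]
    exact mul_le_mul_of_nonneg_right (by exact_mod_cast l1_offZ_le_dL L i.1) ha
  have h2 : ‖tsum V₀ A y (treeWord (offZ L i.1))‖ ≤ (d * L) * a := by
    refine (norm_tsum_le hV₀ hA _ _).trans ?_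
    rw [length_treeWord]
    exact mul_le_mul_of_nonneg_right (by exact_mod_cast l1_offZ_le_dL L i.1) ha
  exact (norm_sub_le _ _).trans (by linarith)

/-- Hence the carried gauge term of one step is at most `4dL·|A|` in the trivial count (`V̄₀(c) ∈ U1`). [cite: Balaban1985Averaging, (125)–(126) p.36] -/
theorem norm_dcovZ_lamZ_le_length (hL : 1 ≤ L) {V₀ : SiteZ d → Fin d → 𝔸ˣ} (hV₀ : ∀ x κ, V₀ x κ ∈ U1 𝔸)
    {A : SiteZ d → Fin d → 𝔸} {a : ℝ} (ha : 0 ≤ a) (hA : ∀ x κ, ‖A x κ‖ ≤ a) (q : SiteZ d) (κ : Fin d)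
    (hb : bavgZ L V₀ q κ ∈ U1 𝔸) : ‖dcovZ L V₀ (lamZ L V₀ A) q κ‖ ≤ 4 * (d * L) * a :=
  (norm_dcovZ_le_of_sup L (fun y => norm_lamZ_le_length L hL hV₀ ha hA y) q κ hb).trans (by ring_nf; rfl)

omit [CompleteSpace 𝔸] in
/-- ★★★ **THE N2 ESTIMATE (road (A′)): `‖λ_A(y)‖ ≤ (d·s)²·P + 36(d·s)²(d·s + 4)·α₀·|A|`** at a background `V₀ ∈ U1` with `|V₀(∂p) − 1| ≤ α₀` ((44)∕(52)), `L = 2s + 1`, `P` a bound of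
the COVARIANT plaquette curls `‖(R_{0,x}A)(∂p)‖` for base points within `d·s` of `y`: the carried coarse gauge letter is controlled by the CURVATURE of `A` on the block and the regularity
of the background — not by `sup|A|` (`norm_lamZ_le_length`).  This is the bound the road's (1.56)-data step consumes (SOCKET-CHECK-N2.md, director-ym №266: the carried letter is absorbed
into the data `B₁`, bounded by the plaquette smallness `HThm4Rec` already carries). [cite: Balaban1985Averaging, (44) p.24, (112) p.34, (124)–(126) p.36; Balaban1987RG1, (0.3)–(0.4) pp.252–253] -/
theorem norm_lamZ_le {s : ℕ} (hL : L = 2 * s + 1) {V₀ : SiteZ d → Fin d → 𝔸ˣ} (hV₀ : ∀ x κ, V₀ x κ ∈ U1 𝔸)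
    {α : ℝ} (hα : 0 ≤ α) (h44 : ∀ (x : SiteZ d) (κ μ : Fin d), κ ≠ μ → ‖((hol V₀ x (plaqWord κ μ) : 𝔸ˣ) : 𝔸) - 1‖ ≤ α)
    {A : SiteZ d → Fin d → 𝔸} {a : ℝ} (ha : 0 ≤ a) (hA : ∀ x κ, ‖A x κ‖ ≤ a) (y : SiteZ d)
    {P : ℝ} (hP0 : 0 ≤ P) (hP : ∀ (x : SiteZ d) (μ ν : Fin d), μ ≠ ν → l1 (x - y) ≤ d * s → ‖tsum V₀ A x (plaqWord μ ν)‖ ≤ P) :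
    ‖lamZ L V₀ A y‖ ≤ ((d : ℝ) * s) ^ 2 * P + 36 * ((d : ℝ) * s) ^ 2 * ((d : ℝ) * s + 4) * α * a := by
  rw [lamZ_def]
  exact norm_stairMean_sub_FhatCovZ_le L hL hV₀ hα h44 ha hA y hP0 hP

/-- ★ **THE CARRIED GAUGE TERM OF ONE `L`-BOND**: `‖(d_{V̄₀}λ_A)(c)‖ ≤ 2·[(d·s)²·P + 36(d·s)²(d·s+4)·α₀·|A|]` for `V̄₀(c) ∈ U1` and a curl bound `P` valid on both blocks `B(c₋)`, `B(c₊)`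
(here: globally). [cite: Balaban1985Averaging, (93) p.31, (124)–(126) p.36; Balaban1987RG1, (0.4) p.253] -/
theorem norm_dcovZ_lamZ_le {s : ℕ} (hL : L = 2 * s + 1) {V₀ : SiteZ d → Fin d → 𝔸ˣ} (hV₀ : ∀ x κ, V₀ x κ ∈ U1 𝔸)
    {α : ℝ} (hα : 0 ≤ α) (h44 : ∀ (x : SiteZ d) (κ μ : Fin d), κ ≠ μ → ‖((hol V₀ x (plaqWord κ μ) : 𝔸ˣ) : 𝔸) - 1‖ ≤ α)
    {A : SiteZ d → Fin d → 𝔸} {a : ℝ} (ha : 0 ≤ a) (hA : ∀ x κ, ‖A x κ‖ ≤ a)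
    {P : ℝ} (hP0 : 0 ≤ P) (hP : ∀ (x : SiteZ d) (μ ν : Fin d), μ ≠ ν → ‖tsum V₀ A x (plaqWord μ ν)‖ ≤ P)
    (q : SiteZ d) (κ : Fin d) (hb : bavgZ L V₀ q κ ∈ U1 𝔸) :
    ‖dcovZ L V₀ (lamZ L V₀ A) q κ‖ ≤ 2 * (((d : ℝ) * s) ^ 2 * P + 36 * ((d : ℝ) * s) ^ 2 * ((d : ℝ) * s + 4) * α * a) :=
  norm_dcovZ_le_of_sup L (fun y => norm_lamZ_le L hL hV₀ hα h44 ha hA y hP0 (fun x μ ν hμν _ => hP x μ ν hμν)) q κ hb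

end Norms

end Literature.MathematicalPhysics.QuantumFieldTheory.Balaban1983to89.B7Prop3GaugeCarryRec
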